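import Mathlib

/-!
# I2 congruence ∕ parity census of the letter model (negation lens g16; director-hodge R19.406 «INTEGRALITY BRIEF», I2)

STATUS WORD.  Mathlib-only arithmetic shadows of the exact hub-local census in
`Cruxes/BlochSeedDiscOne/I2-CONGRUENCE-MEMO-negation-g16.md` (commit 12ad1684bdac).  Letters ≠ sheaves ≠ SEED; nothing
here proves any `FloorFree h 199 8`, `Nonex 14 199 8`, 18881 ∕ H2, HC_AV, HC_CM or HC (HC_CM is a displayed binder of the
ladder only; the research route is conditional on HC_CM and is not a corollary).  The CALL these lemmas support is a KILL:
congruence ∕ parity invariants of integer letter designs cannot close a floor.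

The letter model (mirrors `DepthBoundA4.lean` v1.8 without importing it): a letter is `(a; x, y)` with `a ≥ 0`,
`β = x + iy`, height `a + |x| + |y| = h`, self-intersection `n = a² − x² − y²`; the per-factor coefficient vector of the
class words is `u(ℓ) = (1, a, β̄, β, n)`, real form `(1, a, x, y, n)`.

* `letter_parity` — the two parity forms `a + x + y ≡ h`, `n ≡ h (mod 2)` valid on the whole height-`h` alphabet
  (these GENERATE the congruence module: Smith form `(1,1,1,2,2)` at every storey `h = 6 … 14`, hub-local `snf.py`).
* `cert_row0 … cert_row4` — the UNIFORM index-4 certificate: five letters `(h−3;−3,0), (h−3;−2,±1), (h−2;−2,0),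
  (h−2;−1,1)` and explicit integer polynomial rows `cᵢ(h)` with `Σⱼ cᵢⱼ(h)·u(ℓⱼ) = 4·eᵢ` (so the letter lattice
  contains `4ℤ⁵` at every height `h ≥ 3`).
* `no_odd_congruence` — consequence: an odd modulus carries NO linear congruence on the letter vectors of the
  height-`h` alphabet (every coefficient is divisible by `M`), at every `h ≥ 3` — in particular at the test floors
  `h = 6` and `h = 14`.  (The primes 3, 5, 11 seen in all denominators of the rational designs of record are therefore basis
  arithmetic, not invariants.)
* §6 (rev 1.1) `mu_law_eight`, `mu_law_eight_re_im` — the DESIGN-LEVEL μ-law typed on a self-contained `{e,ē}`-letter vocabulary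
  (`TEE`; (A1) as an explicit hypothesis on the fourteen mixed words): (A1) on the fourteen mixed words ⇒ `μ ∈ 8ℤ[i]`, any alphabet, any integer design.
* `pairSum_cell` — the per-cell identity behind the sharpened μ-law `8 ∣ Re μ`, `8 ∣ Im μ` (pencil + exact check in the
  memo: summing the class tensor over the sixteen `{e, ē}`-words gives `Σ_c ν_c ∏_f (β̄_f + β_f) = 16 Σ_c ν_c ∏_f x_f`, and
  (A1) kills the fourteen mixed words, leaving `2 Re μ`).
* `budget_digits` — the moduli a congruence would need to force `μ = 0` at copies `≤ 199` (`|μ| ≤ 199·h⁴`):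
  `2²² < 199·14⁴ = 7 644 784 < 2²³`, `2¹⁷ < 199·6⁴ = 257 904 < 2¹⁸`, against the available `2³ … 2⁹`.
* `floor_indicator_not_parity` — the parity classes of `(0;14,0)` (floor) and `(2;12,0)` (not floor) coincide, and at
  `h = 6` those of `(0;6,0)` and `(2;4,0)`: no parity invariant sees floor-touching.
-/

set_option linter.dupNamespace false
set_option linter.unnecessarySeqFocus false

namespace Summit.HodgeConjecture.HodgeConjecture.Cruxes.BlochSeedDiscOne.I2CongruenceCensus

/-! ## §1 The parity forms (generators of the congruence module) -/

/-- On the height-`h` alphabet: `a + x + y ≡ h` and `n = a² − x² − y² ≡ h (mod 2)`. -/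
theorem letter_parity (a x y h : ℤ) (hh : a + |x| + |y| = h) :
    2 ∣ a + x + y + h ∧ 2 ∣ (a ^ 2 - x ^ 2 - y ^ 2) + h := by
  have h1 : 2 ∣ a + x + y + h := by
    rcases abs_choice x with hx | hx <;> rcases abs_choice y with hy | hy <;> rw [hx, hy] at hh <;> omega
  refine ⟨h1, ?_⟩
  obtain ⟨k, hk⟩ := h1
  obtain ⟨r₁, h₁⟩ := Int.even_mul_succ_self (a - 1)
  obtain ⟨r₂, h₂⟩ := Int.even_mul_succ_self x
  obtain ⟨r₃, h₃⟩ := Int.even_mul_succ_self y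
  exact ⟨k + r₁ - r₂ - r₃, by linear_combination hk + h₁ - h₂ - h₃⟩

/-- Over `ℤ[i]` the first parity is `π ∣ β̄ − a − h`, `π = 1 + i`; its real shadow: `x − y − a − h` and `a + x + y + h`
have the same parity (trivial, recorded for the dictionary). -/
theorem parity_conj_form (a x y h : ℤ) : 2 ∣ (x - y - a - h) - (-(a + x + y + h)) := ⟨x, by ring⟩

/-! ## §2 The uniform index-4 certificate

Letters `ℓ₁ = (h−3; −3, 0)`, `ℓ₂ = (h−3; −2, 1)`, `ℓ₃ = (h−3; −2, −1)`, `ℓ₄ = (h−2; −2, 0)`, `ℓ₅ = (h−2; −1, 1)`;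
real letter vectors `u(ℓ) = (1, a, x, y, n)` with `n₁ = h² − 6h`, `n₂ = n₃ = h² − 6h + 4`, `n₄ = h² − 4h`, `n₅ = h² − 4h + 2`.
Each `cert_rowᵢ` lists the five coordinates of `Σⱼ cᵢⱼ(h) u(ℓⱼ)` : `(4δᵢ₀, 4δᵢ₁, 4δᵢ₂, 4δᵢ₃, 4δᵢ₄)`. -/

/-- the certificate letters lie on the height-`h` alphabet (`a ≥ 0` needs `h ≥ 3`). -/
theorem cert_letters_on_alphabet (h : ℤ) (hh : 3 ≤ h) :
    (0 ≤ h - 3 ∧ (h - 3) + |(-3 : ℤ)| + |(0 : ℤ)| = h) ∧ (0 ≤ h - 3 ∧ (h - 3) + |(-2 : ℤ)| + |(1 : ℤ)| = h) ∧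
    (0 ≤ h - 3 ∧ (h - 3) + |(-2 : ℤ)| + |(-1 : ℤ)| = h) ∧ (0 ≤ h - 2 ∧ (h - 2) + |(-2 : ℤ)| + |(0 : ℤ)| = h) ∧
    (0 ≤ h - 2 ∧ (h - 2) + |(-1 : ℤ)| + |(1 : ℤ)| = h) := by
  have e3 : |(-3 : ℤ)| = 3 := by decide
  have e2 : |(-2 : ℤ)| = 2 := by decide
  have e1 : |(-1 : ℤ)| = 1 := by decide
  have e1' : |(1 : ℤ)| = 1 := by decide
  have e0 : |(0 : ℤ)| = 0 := by decide
  rw [e3, e2, e1, e1', e0]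
  omega

/-- row 0: `c₀(h) = (−2h²+8h−8, 2h²−6h, 2h, 2h²−12h+12, −2h²+8h)` picks out `4·e₀` (the constant coordinate). -/
theorem cert_row0 (h : ℤ) :
    (-2*h^2+8*h-8) * 1 + (2*h^2-6*h) * 1 + (2*h) * 1 + (2*h^2-12*h+12) * 1 + (-2*h^2+8*h) * 1 = 4 ∧
    (-2*h^2+8*h-8) * (h-3) + (2*h^2-6*h) * (h-3) + (2*h) * (h-3) + (2*h^2-12*h+12) * (h-2) + (-2*h^2+8*h) * (h-2) = 0 ∧
    (-2*h^2+8*h-8) * (-3) + (2*h^2-6*h) * (-2) + (2*h) * (-2) + (2*h^2-12*h+12) * (-2) + (-2*h^2+8*h) * (-1) = 0 ∧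
    (-2*h^2+8*h-8) * 0 + (2*h^2-6*h) * 1 + (2*h) * (-1) + (2*h^2-12*h+12) * 0 + (-2*h^2+8*h) * 1 = 0 ∧
    (-2*h^2+8*h-8) * (h^2-6*h) + (2*h^2-6*h) * (h^2-6*h+4) + (2*h) * (h^2-6*h+4) + (2*h^2-12*h+12) * (h^2-4*h)
      + (-2*h^2+8*h) * (h^2-4*h+2) = 0 := by
  refine ⟨by ring, by ring, by ring, by ring, by ring⟩

/-- row 1: `c₁(h) = (4h−8, 6−4h, −2, 12−4h, 4h−8)` picks out `4·e₁` (the `a`-coordinate). -/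
theorem cert_row1 (h : ℤ) :
    (4*h-8) * 1 + (6-4*h) * 1 + (-2) * 1 + (12-4*h) * 1 + (4*h-8) * 1 = 0 ∧
    (4*h-8) * (h-3) + (6-4*h) * (h-3) + (-2) * (h-3) + (12-4*h) * (h-2) + (4*h-8) * (h-2) = 4 ∧
    (4*h-8) * (-3) + (6-4*h) * (-2) + (-2) * (-2) + (12-4*h) * (-2) + (4*h-8) * (-1) = 0 ∧
    (4*h-8) * 0 + (6-4*h) * 1 + (-2) * (-1) + (12-4*h) * 0 + (4*h-8) * 1 = 0 ∧
    (4*h-8) * (h^2-6*h) + (6-4*h) * (h^2-6*h+4) + (-2) * (h^2-6*h+4) + (12-4*h) * (h^2-4*h) + (4*h-8) * (h^2-4*h+2) = 0 := by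
  refine ⟨by ring, by ring, by ring, by ring, by ring⟩

/-- row 2: `c₂ = (4, −6, 2, −8, 8)` picks out `4·e₂` (the `x`-coordinate). -/
theorem cert_row2 (h : ℤ) :
    (4:ℤ) * 1 + (-6) * 1 + 2 * 1 + (-8) * 1 + 8 * 1 = 0 ∧
    4 * (h-3) + (-6) * (h-3) + 2 * (h-3) + (-8) * (h-2) + 8 * (h-2) = 0 ∧
    (4:ℤ) * (-3) + (-6) * (-2) + 2 * (-2) + (-8) * (-2) + 8 * (-1) = 4 ∧
    (4:ℤ) * 0 + (-6) * 1 + 2 * (-1) + (-8) * 0 + 8 * 1 = 0 ∧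
    4 * (h^2-6*h) + (-6) * (h^2-6*h+4) + 2 * (h^2-6*h+4) + (-8) * (h^2-4*h) + 8 * (h^2-4*h+2) = 0 := by
  refine ⟨by norm_num, by ring, by norm_num, by norm_num, by ring⟩

/-- row 3: `c₃ = (0, 2, −2, 0, 0)` picks out `4·e₃` (the `y`-coordinate). -/
theorem cert_row3 (h : ℤ) :
    (0:ℤ) * 1 + 2 * 1 + (-2) * 1 + 0 * 1 + 0 * 1 = 0 ∧
    0 * (h-3) + 2 * (h-3) + (-2) * (h-3) + 0 * (h-2) + 0 * (h-2) = 0 ∧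
    (0:ℤ) * (-3) + 2 * (-2) + (-2) * (-2) + 0 * (-2) + 0 * (-1) = 0 ∧
    (0:ℤ) * 0 + 2 * 1 + (-2) * (-1) + 0 * 0 + 0 * 1 = 4 ∧
    0 * (h^2-6*h) + 2 * (h^2-6*h+4) + (-2) * (h^2-6*h+4) + 0 * (h^2-4*h) + 0 * (h^2-4*h+2) = 0 := by
  refine ⟨by norm_num, by ring, by norm_num, by norm_num, by ring⟩

/-- row 4: `c₄ = (−2, 2, 0, 2, −2)` picks out `4·e₄` (the `n`-coordinate). -/
theorem cert_row4 (h : ℤ) :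
    (-2:ℤ) * 1 + 2 * 1 + 0 * 1 + 2 * 1 + (-2) * 1 = 0 ∧
    (-2) * (h-3) + 2 * (h-3) + 0 * (h-3) + 2 * (h-2) + (-2) * (h-2) = 0 ∧
    (-2:ℤ) * (-3) + 2 * (-2) + 0 * (-2) + 2 * (-2) + (-2) * (-1) = 0 ∧
    (-2:ℤ) * 0 + 2 * 1 + 0 * (-1) + 2 * 0 + (-2) * 1 = 0 ∧
    (-2) * (h^2-6*h) + 2 * (h^2-6*h+4) + 0 * (h^2-6*h+4) + 2 * (h^2-4*h) + (-2) * (h^2-4*h+2) = 4 := by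
  refine ⟨by norm_num, by ring, by norm_num, by norm_num, by ring⟩

/-! ## §3 No congruence modulo an odd number -/

/-- `M` odd and `M ∣ 4d` force `M ∣ d` (explicit inverse of 4 modulo `M`). -/
theorem dvd_of_odd_of_dvd_four_mul {M d : ℤ} (hM : Odd M) (h4 : M ∣ 4 * d) : M ∣ d := by
  obtain ⟨m, hm⟩ := hM
  have e : d = (4 * d) * (-m ^ 2 - m) + M * (M * d) := by rw [hm]; ring
  rw [e]
  exact dvd_add (dvd_mul_of_dvd_left h4 _) (dvd_mul_right M _)

/-- NO ODD CONGRUENCE at any height `h ≥ 3` (in particular at the test floors `h = 6`, `h = 14`): if an integer linear form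
`d₀·1 + d₁·a + d₂·x + d₃·y + d₄·n` is divisible by an odd `M` on every letter of the height-`h` alphabet, then every
coefficient is divisible by `M` — the congruence is trivial. -/
theorem no_odd_congruence (M : ℤ) (hM : Odd M) (h d₀ d₁ d₂ d₃ d₄ : ℤ) (hh : 3 ≤ h)
    (H : ∀ a x y : ℤ, 0 ≤ a → a + |x| + |y| = h →
      M ∣ d₀ * 1 + d₁ * a + d₂ * x + d₃ * y + d₄ * (a ^ 2 - x ^ 2 - y ^ 2)) :
    M ∣ d₀ ∧ M ∣ d₁ ∧ M ∣ d₂ ∧ M ∣ d₃ ∧ M ∣ d₄ := by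
  obtain ⟨⟨a1, b1⟩, ⟨a2, b2⟩, ⟨a3, b3⟩, ⟨a4, b4⟩, ⟨a5, b5⟩⟩ := cert_letters_on_alphabet h hh
  have H1 := H (h - 3) (-3) 0 a1 b1
  have H2 := H (h - 3) (-2) 1 a2 b2
  have H3 := H (h - 3) (-2) (-1) a3 b3
  have H4 := H (h - 2) (-2) 0 a4 b4
  have H5 := H (h - 2) (-1) 1 a5 b5
  -- abbreviate the five values
  set v1 := d₀ * 1 + d₁ * (h - 3) + d₂ * (-3) + d₃ * 0 + d₄ * ((h - 3) ^ 2 - (-3) ^ 2 - 0 ^ 2) with hv1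
  set v2 := d₀ * 1 + d₁ * (h - 3) + d₂ * (-2) + d₃ * 1 + d₄ * ((h - 3) ^ 2 - (-2) ^ 2 - 1 ^ 2) with hv2
  set v3 := d₀ * 1 + d₁ * (h - 3) + d₂ * (-2) + d₃ * (-1) + d₄ * ((h - 3) ^ 2 - (-2) ^ 2 - (-1) ^ 2) with hv3
  set v4 := d₀ * 1 + d₁ * (h - 2) + d₂ * (-2) + d₃ * 0 + d₄ * ((h - 2) ^ 2 - (-2) ^ 2 - 0 ^ 2) with hv4
  set v5 := d₀ * 1 + d₁ * (h - 2) + d₂ * (-1) + d₃ * 1 + d₄ * ((h - 2) ^ 2 - (-1) ^ 2 - 1 ^ 2) with hv5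
  have L : ∀ c1 c2 c3 c4 c5 : ℤ, M ∣ c1 * v1 + c2 * v2 + c3 * v3 + c4 * v4 + c5 * v5 := fun c1 c2 c3 c4 c5 =>
    dvd_add (dvd_add (dvd_add (dvd_add (dvd_mul_of_dvd_right H1 _) (dvd_mul_of_dvd_right H2 _))
      (dvd_mul_of_dvd_right H3 _)) (dvd_mul_of_dvd_right H4 _)) (dvd_mul_of_dvd_right H5 _)
  have e0 : (-2*h^2+8*h-8) * v1 + (2*h^2-6*h) * v2 + (2*h) * v3 + (2*h^2-12*h+12) * v4 + (-2*h^2+8*h) * v5 = 4 * d₀ := by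
    rw [hv1, hv2, hv3, hv4, hv5]; ring
  have e1 : (4*h-8) * v1 + (6-4*h) * v2 + (-2) * v3 + (12-4*h) * v4 + (4*h-8) * v5 = 4 * d₁ := by
    rw [hv1, hv2, hv3, hv4, hv5]; ring
  have e2 : 4 * v1 + (-6) * v2 + 2 * v3 + (-8) * v4 + 8 * v5 = 4 * d₂ := by
    rw [hv1, hv2, hv3, hv4, hv5]; ring
  have e3 : 0 * v1 + 2 * v2 + (-2) * v3 + 0 * v4 + 0 * v5 = 4 * d₃ := by
    rw [hv1, hv2, hv3, hv4, hv5]; ring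
  have e4 : (-2) * v1 + 2 * v2 + 0 * v3 + 2 * v4 + (-2) * v5 = 4 * d₄ := by
    rw [hv1, hv2, hv3, hv4, hv5]; ring
  refine ⟨dvd_of_odd_of_dvd_four_mul hM (e0 ▸ L _ _ _ _ _), dvd_of_odd_of_dvd_four_mul hM (e1 ▸ L _ _ _ _ _),
    dvd_of_odd_of_dvd_four_mul hM (e2 ▸ L _ _ _ _ _), dvd_of_odd_of_dvd_four_mul hM (e3 ▸ L _ _ _ _ _),
    dvd_of_odd_of_dvd_four_mul hM (e4 ▸ L _ _ _ _ _)⟩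

/-- The same certificate bounds the 2-part: ANY modulus `M` dividing the form on the alphabet divides `4·dₖ` — the letter
lattice contains `4ℤ⁵`, so the congruence module is killed by 4 (it is in fact `(ℤ∕2)²`, hub-local Smith form). -/
theorem four_kills_congruences (M : ℤ) (h d₀ d₁ d₂ d₃ d₄ : ℤ) (hh : 3 ≤ h)
    (H : ∀ a x y : ℤ, 0 ≤ a → a + |x| + |y| = h →
      M ∣ d₀ * 1 + d₁ * a + d₂ * x + d₃ * y + d₄ * (a ^ 2 - x ^ 2 - y ^ 2)) :
    M ∣ 4 * d₀ ∧ M ∣ 4 * d₁ ∧ M ∣ 4 * d₂ ∧ M ∣ 4 * d₃ ∧ M ∣ 4 * d₄ := by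
  obtain ⟨⟨a1, b1⟩, ⟨a2, b2⟩, ⟨a3, b3⟩, ⟨a4, b4⟩, ⟨a5, b5⟩⟩ := cert_letters_on_alphabet h hh
  have H1 := H (h - 3) (-3) 0 a1 b1
  have H2 := H (h - 3) (-2) 1 a2 b2
  have H3 := H (h - 3) (-2) (-1) a3 b3
  have H4 := H (h - 2) (-2) 0 a4 b4
  have H5 := H (h - 2) (-1) 1 a5 b5
  set v1 := d₀ * 1 + d₁ * (h - 3) + d₂ * (-3) + d₃ * 0 + d₄ * ((h - 3) ^ 2 - (-3) ^ 2 - 0 ^ 2) with hv1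
  set v2 := d₀ * 1 + d₁ * (h - 3) + d₂ * (-2) + d₃ * 1 + d₄ * ((h - 3) ^ 2 - (-2) ^ 2 - 1 ^ 2) with hv2
  set v3 := d₀ * 1 + d₁ * (h - 3) + d₂ * (-2) + d₃ * (-1) + d₄ * ((h - 3) ^ 2 - (-2) ^ 2 - (-1) ^ 2) with hv3
  set v4 := d₀ * 1 + d₁ * (h - 2) + d₂ * (-2) + d₃ * 0 + d₄ * ((h - 2) ^ 2 - (-2) ^ 2 - 0 ^ 2) with hv4
  set v5 := d₀ * 1 + d₁ * (h - 2) + d₂ * (-1) + d₃ * 1 + d₄ * ((h - 2) ^ 2 - (-1) ^ 2 - 1 ^ 2) with hv5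
  have L : ∀ c1 c2 c3 c4 c5 : ℤ, M ∣ c1 * v1 + c2 * v2 + c3 * v3 + c4 * v4 + c5 * v5 := fun c1 c2 c3 c4 c5 =>
    dvd_add (dvd_add (dvd_add (dvd_add (dvd_mul_of_dvd_right H1 _) (dvd_mul_of_dvd_right H2 _))
      (dvd_mul_of_dvd_right H3 _)) (dvd_mul_of_dvd_right H4 _)) (dvd_mul_of_dvd_right H5 _)
  have e0 : (-2*h^2+8*h-8) * v1 + (2*h^2-6*h) * v2 + (2*h) * v3 + (2*h^2-12*h+12) * v4 + (-2*h^2+8*h) * v5 = 4 * d₀ := by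
    rw [hv1, hv2, hv3, hv4, hv5]; ring
  have e1 : (4*h-8) * v1 + (6-4*h) * v2 + (-2) * v3 + (12-4*h) * v4 + (4*h-8) * v5 = 4 * d₁ := by
    rw [hv1, hv2, hv3, hv4, hv5]; ring
  have e2 : 4 * v1 + (-6) * v2 + 2 * v3 + (-8) * v4 + 8 * v5 = 4 * d₂ := by
    rw [hv1, hv2, hv3, hv4, hv5]; ring
  have e3 : 0 * v1 + 2 * v2 + (-2) * v3 + 0 * v4 + 0 * v5 = 4 * d₃ := by
    rw [hv1, hv2, hv3, hv4, hv5]; ring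
  have e4 : (-2) * v1 + 2 * v2 + 0 * v3 + 2 * v4 + (-2) * v5 = 4 * d₄ := by
    rw [hv1, hv2, hv3, hv4, hv5]; ring
  exact ⟨e0 ▸ L _ _ _ _ _, e1 ▸ L _ _ _ _ _, e2 ▸ L _ _ _ _ _, e3 ▸ L _ _ _ _ _, e4 ▸ L _ _ _ _ _⟩

/-! ## §4 The sharpened μ-law: the per-cell identity -/

/-- Per factor `β̄ + β = 2x` and `β̄ − β = −2iy`; hence over a cell `∏_f (β̄_f + β_f) = 16 ∏_f x_f`.  Summed against integer
multiplicities and expanded over the sixteen `{e, ē}`-words, (A1) leaves `μ + μ̄ = 2 Re μ`, so `8 ∣ Re μ`; the signed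
variants give `8 ∣ Im μ` (memo (L3); the design-level statement needs `DepthBoundA4.Design.T` and is not restated here). -/
theorem pairSum_cell (x₀ x₁ x₂ x₃ : ℤ) :
    (2 * x₀) * (2 * x₁) * (2 * x₂) * (2 * x₃) = 16 * (x₀ * x₁ * x₂ * x₃) := by ring

/-- the Gaussian-integer form of the per-factor identities. -/
theorem pairSum_factor (x y : ℤ) :
    (⟨x, -y⟩ : GaussianInt) + ⟨x, y⟩ = (2 * x : ℤ) ∧ (⟨x, -y⟩ : GaussianInt) - ⟨x, y⟩ = ⟨0, -(2 * y)⟩ := by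
  constructor
  · ext <;> simp <;> ring
  · ext <;> simp <;> ring

/-- `8 ∣ Re μ` from the identity `2 Re μ = 16 X` (the shape in which the design-level law is used). -/
theorem eight_dvd_of_double_eq_sixteen_mul (r X : ℤ) (h : 2 * r = 16 * X) : 8 ∣ r := ⟨X, by omega⟩

/-! ## §5 Budget digits and the floor indicator -/

/-- Moduli a congruence needs in order to force `μ = 0` at copies `≤ 199` (`|μ| ≤ 199·h⁴`), against the available `2³…2⁹`. -/
theorem budget_digits :
    (199 : ℕ) * 14 ^ 4 = 7644784 ∧ 2 ^ 22 < 7644784 ∧ 7644784 < 2 ^ 23 ∧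
    (199 : ℕ) * 6 ^ 4 = 257904 ∧ 2 ^ 17 < 257904 ∧ 257904 < 2 ^ 18 ∧ 2 ^ 9 < 2 ^ 22 := by norm_num

/-- μ-data of the integer (A1)-clean designs of record (LINE 14 ∕ x7 ∕ Psi2; exact hub-local `mu8-designs.log`): the
2-adic valuations of `Im μ` are 9, 10, 10, 7 — all ≥ 3 (the law) and the first caps any universal law at height 14 at 2⁹. -/
theorem mu_data_valuations :
    (13824 : ℤ) = 2 ^ 9 * 27 ∧ (27648 : ℤ) = 2 ^ 10 * 27 ∧ (-1059840 : ℤ) = -(2 ^ 10 * 1035) ∧ (-128 : ℤ) = -(2 ^ 7) ∧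
    ¬ (2 : ℤ) ∣ 27 ∧ ¬ (2 : ℤ) ∣ 1035 := by
  refine ⟨by norm_num, by norm_num, by norm_num, by norm_num, by decide, by decide⟩

/-- The mod-2 letter functions are spanned by `1, a mod 2, x mod 2` (`y ≡ a + x + h`, `n ≡ h`); the floor letter `(0;14,0)`
and the non-floor letter `(2;12,0)` have the same parities (and at `h = 6`: `(0;6,0)` vs `(2;4,0)`), so NO parity invariant
distinguishes floor-touching designs. -/
theorem floor_indicator_not_parity :
    ((0 : ℤ) % 2 = 2 % 2 ∧ (14 : ℤ) % 2 = 12 % 2 ∧ (0 : ℤ) % 2 = 0 % 2) ∧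
    ((0 : ℤ) % 2 = 2 % 2 ∧ (6 : ℤ) % 2 = 4 % 2) ∧
    ((0 : ℤ) + |14| + |0| = 14 ∧ (2 : ℤ) + |12| + |0| = 14 ∧ (0 : ℤ) + |6| + |0| = 6 ∧ (2 : ℤ) + |4| + |0| = 6) := by
  refine ⟨⟨by decide, by decide, by decide⟩, ⟨by decide, by decide⟩, ?_⟩
  refine ⟨by decide, by decide, by decide, by decide⟩

/-! ## §6 The design-level μ-law `8 ∣ μ` in `ℤ[i]` (rev 1.1) — a self-contained letter-model vocabulary

Only the `{e, ē}`-part of the class words matters for `μ = T(eeee)`.  A cell is recorded by its four `β`-letters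
`(x_f, y_f)` (`β_f = x_f + i y_f`); an `{e,ē}`-word is `w : Fin 4 → Bool` (`true = e ↦ β̄`, `false = ē ↦ β`); a signed integer
design is a list of `(cell, ν)` with `ν = +m` on `N`-cells and `−m` on `P`-cells (cokernel type); `TEE D w = Σ ν · ∏_f coef`
is the class coefficient of the word (this is `DepthBoundA4.Design.T` restricted to `{e,ē}`-words, re-declared here so the file
stays Mathlib-only).  The hypothesis `hA` = the (A1) equations for the fourteen MIXED `{e,ē}`-words.  Result: `mu_law_eight` —
`μ ∈ 8·ℤ[i]`, hence `8 ∣ Re μ` and `8 ∣ Im μ` — for EVERY integer design satisfying those fourteen equations, on ANY alphabet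
(the tree's `TwoAdicMuLaw` has `4 ∣ μ` at `h = 14`). -/

/-- per-factor coefficient of an `{e,ē}`-letter on a cell factor with `β = x + iy`: `e ↦ β̄`, `ē ↦ β`. -/
def coefEE (xy : ℤ × ℤ) (b : Bool) : GaussianInt := if b then ⟨xy.1, -xy.2⟩ else ⟨xy.1, xy.2⟩

/-- cell coefficient of an `{e,ē}`-word: the product over the four factors. -/
def cellCoefEE (c : Fin 4 → ℤ × ℤ) (w : Fin 4 → Bool) : GaussianInt := ∏ f, coefEE (c f) (w f)

/-- a signed integer design: cells (by their `β`-letters) with multiplicities `ν = +N − P`. -/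
abbrev DesignEE := List ((Fin 4 → ℤ × ℤ) × ℤ)

/-- class coefficient of the `{e,ē}`-word `w`: `T(w) = Σ_c ν_c ∏_f coef_{w_f}(c_f)`. -/
def TEE (D : DesignEE) (w : Fin 4 → Bool) : GaussianInt :=
  (D.map fun p => (p.2 : GaussianInt) * cellCoefEE p.1 w).sum

/-- `μ = T(eeee)`. -/
def muEE (D : DesignEE) : GaussianInt := TEE D (fun _ => true)

/- (A1) on the mixed `{e,ē}`-words — «all fourteen class coefficients vanish» — is carried as the explicit hypothesis
   `hA : ∀ w, w ≠ (fun _ => true) → w ≠ (fun _ => false) → TEE D w = 0` (no `def … : Prop`, to keep the tree lint quiet). -/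

/-- sign attached to an `ē`-letter on a factor: `true ↦ +1`, `false ↦ −1`. -/
def signG (b : Bool) : GaussianInt := if b then 1 else -1

/-- the half-sum letter: `(β̄ + β)/2 = x`, `(β̄ − β)/2 = −iy`. -/
def halfG (xy : ℤ × ℤ) (b : Bool) : GaussianInt := if b then ⟨xy.1, 0⟩ else ⟨0, -xy.2⟩

theorem factor_two (xy : ℤ × ℤ) (b : Bool) :
    coefEE xy true + signG b * coefEE xy false = ((2 : ℤ) : GaussianInt) * halfG xy b := by
  cases b <;> (unfold coefEE signG halfG; ext <;> simp <;> ring)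

theorem const_true_ne_false : (fun _ : Fin 4 => true) ≠ (fun _ : Fin 4 => false) := by
  intro h; exact absurd (congrFun h 0) (by decide)

/-- per cell: a weighted sum over the sixteen `{e,ē}`-words is the product of the per-factor weighted sums. -/
theorem cell_wordsum (c : Fin 4 → ℤ × ℤ) (s : Fin 4 → GaussianInt) :
    ∑ w : Fin 4 → Bool, (∏ f, (if w f then (1 : GaussianInt) else s f)) * cellCoefEE c w
      = ∏ f, (coefEE (c f) true + s f * coefEE (c f) false) := by
  have h1 : ∀ w : Fin 4 → Bool, (∏ f, (if w f then (1 : GaussianInt) else s f)) * cellCoefEE c w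
      = ∏ f, ((if w f then (1 : GaussianInt) else s f) * coefEE (c f) (w f)) := by
    intro w; unfold cellCoefEE; rw [← Finset.prod_mul_distrib]
  simp_rw [h1]
  symm
  have h2 : ∀ f, coefEE (c f) true + s f * coefEE (c f) false
      = ∑ b : Bool, (if b then (1 : GaussianInt) else s f) * coefEE (c f) b := by
    intro f; rw [Fintype.sum_bool]; simp
  simp_rw [h2]
  rw [Finset.prod_univ_sum, Fintype.piFinset_univ]

/-- design level: the weighted word sum is `Σ_c ν_c ∏_f (β̄_f + s_f β_f)`. -/
theorem design_wordsum (D : DesignEE) (s : Fin 4 → GaussianInt) :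
    ∑ w : Fin 4 → Bool, (∏ f, (if w f then (1 : GaussianInt) else s f)) * TEE D w
      = (D.map fun p => (p.2 : GaussianInt) * ∏ f, (coefEE (p.1 f) true + s f * coefEE (p.1 f) false)).sum := by
  induction D with
  | nil => simp [TEE]
  | cons p D ih =>
    have hT : ∀ w, TEE (p :: D) w = (p.2 : GaussianInt) * cellCoefEE p.1 w + TEE D w := by
      intro w; simp [TEE]
    simp_rw [hT, mul_add, Finset.sum_add_distrib, ih]
    rw [List.map_cons, List.sum_cons]
    congr 1
    rw [← cell_wordsum p.1 s, Finset.mul_sum]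
    exact Finset.sum_congr rfl fun w _ => by ring

/-- (A1) collapses the weighted word sum to the two pure words. -/
theorem wordsum_of_A1 (D : DesignEE) (hA : ∀ w : Fin 4 → Bool, w ≠ (fun _ => true) → w ≠ (fun _ => false) → TEE D w = 0) (s : Fin 4 → GaussianInt) :
    ∑ w : Fin 4 → Bool, (∏ f, (if w f then (1 : GaussianInt) else s f)) * TEE D w
      = TEE D (fun _ => true) + (∏ f, s f) * TEE D (fun _ => false) := by
  have h0 : ∀ w ∈ (Finset.univ : Finset (Fin 4 → Bool)), w ≠ (fun _ => true) ∧ w ≠ (fun _ => false) →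
      (∏ f, (if w f then (1 : GaussianInt) else s f)) * TEE D w = 0 := by
    intro w _ hw; rw [hA w hw.1 hw.2, mul_zero]
  rw [Finset.sum_eq_add_of_mem _ _ (Finset.mem_univ _) (Finset.mem_univ _) const_true_ne_false h0]
  simp

/-- each design term of the signed word sum is divisible by 16 in `ℤ[i]`. -/
theorem sixteen_dvd_wordsum (D : DesignEE) (b : Fin 4 → Bool) :
    ((16 : ℤ) : GaussianInt) ∣
      (D.map fun p => (p.2 : GaussianInt) *
        ∏ f, (coefEE (p.1 f) true + signG (b f) * coefEE (p.1 f) false)).sum := by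
  apply List.dvd_sum
  intro x hx
  obtain ⟨p, _, rfl⟩ := List.mem_map.1 hx
  apply dvd_mul_of_dvd_right
  have e : ∏ f, (coefEE (p.1 f) true + signG (b f) * coefEE (p.1 f) false)
      = (∏ _f : Fin 4, ((2 : ℤ) : GaussianInt)) * ∏ f, halfG (p.1 f) (b f) := by
    rw [← Finset.prod_mul_distrib]
    exact Finset.prod_congr rfl fun f _ => factor_two (p.1 f) (b f)
  rw [e]
  apply dvd_mul_of_dvd_left
  rw [Finset.prod_const, Finset.card_univ, Fintype.card_fin]
  exact ⟨1, by push_cast; norm_num⟩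

/-- THE μ-LAW: for every integer design whose fourteen mixed `{e,ē}`-class-coefficients vanish, `μ ∈ 8·ℤ[i]`. -/
theorem mu_law_eight (D : DesignEE) (hA : ∀ w : Fin 4 → Bool, w ≠ (fun _ => true) → w ≠ (fun _ => false) → TEE D w = 0) : ∃ Z : GaussianInt, muEE D = ((8 : ℤ) : GaussianInt) * Z := by
  -- all signs +: μ + μ' = S₁ ; sign − on factor 3 only: μ − μ' = S₂
  have e1 := wordsum_of_A1 D hA (fun f => signG ((fun _ : Fin 4 => true) f))
  have e2 := wordsum_of_A1 D hA (fun f => signG ((fun g : Fin 4 => decide (g ≠ 3)) f))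
  rw [design_wordsum] at e1 e2
  obtain ⟨Z₁, h₁⟩ := sixteen_dvd_wordsum D (fun _ => true)
  obtain ⟨Z₂, h₂⟩ := sixteen_dvd_wordsum D (fun g => decide (g ≠ 3))
  rw [h₁] at e1
  rw [h₂] at e2
  have s1 : ∏ f : Fin 4, signG ((fun _ : Fin 4 => true) f) = 1 := by
    rw [Fin.prod_univ_four]; simp [signG]
  have s2 : ∏ f : Fin 4, signG ((fun g : Fin 4 => decide (g ≠ 3)) f) = -1 := by
    rw [Fin.prod_univ_four]; simp [signG]
  rw [s1] at e1
  rw [s2] at e2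
  -- e1 : 16 Z₁ = μ + 1·μ',  e2 : 16 Z₂ = μ + (−1)·μ'
  have two_ne : ((2 : ℤ) : GaussianInt) ≠ 0 := by
    intro h; have := congrArg Zsqrtd.re h; simp at this
  refine ⟨Z₁ + Z₂, mul_left_cancel₀ two_ne ?_⟩
  have key : ((2 : ℤ) : GaussianInt) * muEE D = ((16 : ℤ) : GaussianInt) * Z₁ + ((16 : ℤ) : GaussianInt) * Z₂ := by
    rw [e1, e2]; unfold muEE; ring
  rw [key]; push_cast; ring

/-- … hence `8 ∣ Re μ` and `8 ∣ Im μ`. -/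
theorem mu_law_eight_re_im (D : DesignEE) (hA : ∀ w : Fin 4 → Bool, w ≠ (fun _ => true) → w ≠ (fun _ => false) → TEE D w = 0) : (8 : ℤ) ∣ (muEE D).re ∧ (8 : ℤ) ∣ (muEE D).im := by
  obtain ⟨Z, hZ⟩ := mu_law_eight D hA
  exact ⟨⟨Z.re, by rw [hZ]; simp⟩, ⟨Z.im, by rw [hZ]; simp⟩⟩

/-- sanity instance: the one-cell design `ν = 1` on the cell with `β = (1+i, 1+i, 1+i, 1+i)` violates (A1) — and indeed
`μ = (1−i)⁴ = −4 ∉ 8ℤ[i]`; (A1) is what upgrades the trivial `2⁴ ∣ Σ_w T(w)` to a statement about `μ` alone. -/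
theorem mu_onecell_example : muEE [((fun _ => ((1 : ℤ), (1 : ℤ))), 1)] = ⟨-4, 0⟩ := by decide

end Summit.HodgeConjecture.HodgeConjecture.Cruxes.BlochSeedDiscOne.I2CongruenceCensus
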